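import Summits.QuantumFields.YangMills.Theorems.FluctuationComparisonRegPrIntLS1aTowerLawSandwich
import Summits.QuantumFields.YangMills.Theorems.FluctuationComparisonRegPrIntLWreg
import HarnessLib

/-!
# `FluctuationComparisonRegPrIntLS1aTowerDensityVersion` — S1aᴴ's (p) ∧ (w) FOR ONE VERSION: every law of the cut tower has a measurable non-negative density, STRICTLY
# POSITIVE on the `θBal F.L γ b₁ p₀ j`-window of the plateau parameter `b₁` (the FULL window at the uncut heights), by WREG + the tower-law sandwich (FILE B of two)

Cell `ym3-torus` (YM ladder rung R3 = continuum `SU(2)` Yang–Mills on T³ — NOT d = 4, NOT infinite volume, NOT a mass gap, NOT Clay); width seat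
`ym3-torus-px21` (gen 22), WIDTH COPY of ★p1 «CMP 102 Thm 1's inputs AS PRINTED vs AS TYPED, every gap named».  Helper of the crux
`stmt-QuantumFields-20520` `FluctuationComparisonRegPrIntL` (`--kind proof --supports … --as helper`, count-neutral).  THEOREMS ONLY: definition-free,
default heartbeats, no `instance`∕`notation`.  Imports FILE A ✓`…S1aTowerLawSandwich` (the sandwich `Z_K⁻¹ρ^{E}_{K−j}·dU ≤ μ_j ≤ ν_{K,j}`, `density_sandwich_ae`) and
✓`…Wreg` (the organ WREG `windowRegularity`: the window lies in `Node00.regSet` of the `histGood`-restricted density and its canonical version is positive there).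

WHAT (S1aᴴ `RunClassMembershipH`, `Lines/runpair_organ.lean` v18.4 :534, conjuncts (p) «`0 < ρ_j` on the `θBal F.L γ b₀ p₀ j`-window» and (w) «`μ j = dU_j.withDensity
(ofReal ∘ ρ_j)`», for ONE `ρ_j`; HOME UV3-NODE §67.3 rows (w)(p)):
* `isOpen_window` (bookkeeping);
* ★★★`exists_density_pos_on_window`: for every `L`, `0 < b₁`, `0 < p₀` there is `γ₁ > 0` (WREG's at `(L, b₁, p₀)`) such that for every family of block size `L`, `0 < γ ≤ γ₁`,
  every run system `ν` and cut tower `μ` of S1aᴴ's shape with measurable weights `χ ≤ 1` equal to one on the `θBal F.L γ b₁ p₀ i`-windows for `j < i ≤ Ts`, the law `μ j`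
  (`j ≤ K`) has a MEASURABLE density `ρ_j ≥ 0` with `μ j = dU_j.withDensity (ofReal ∘ ρ_j)`, `0 < ρ_j` on the `θBal F.L γ b₁ p₀ j`-window, and
  `Z_K⁻¹·ρ^{histGood θ′}_{K−j} ≤ ρ_j ≤ Z_K⁻¹·ρ_{K−j}` a.e.  Version: `ρ_j := max (dμ_j∕dU) (W.piecewise (Z_K⁻¹·heightDensityCan …) 0)` (Radon–Nikodym + lit ✓`Node00.canonVersion_ae_eq`
  + ✓`Node00.continuousOn_canonVersion` on `regSet ⊇ W` for measurability);
* ★★`exists_density_pos_on_window_of_le`: at the UNCUT heights `Ts ≤ j ≤ K` no plateau hypothesis is needed and `b₁ > 0` is arbitrary — (p) on S1aᴴ's FULL window there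
  (`b₁ := b₀`);
* ★★★`exists_densities`: one family `ρ : (j : ℕ) → …` for all `j ≤ K` under the global plateau hypothesis `PlaqSmall (θBal F.L γ b₁ p₀ i) U → χ i U = 1` (`i ≤ Ts`) — S1aᴴ's
  `∃ ρ, ∀ j (hjK : j ≤ K), …` shape restricted to (p-on-`b₁`) ∧ (w).

LOCATED RESIDUAL (★p1 «every gap named»; nothing asserted).  For the line's cut `sfCut (θBal F.L γ b₀ p₀ ·)` the plateau parameter is `b₁ = b₀∕2`: at the CUT heights
`j < Ts` this file pays (p) on the HALF window, S1aᴴ names the FULL one; the annulus `θ_j∕2 ≤ maxₚ dist1 < θ_j` needs fine histories over `V` with heights `(j, Ts]` inside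
`{sfCut > 0} = PlaqSmall (24∕25·θ_i)` of positive fibre mass — a one-step small lift of gain `κ√L < 24∕25` STRICT (tree: ✓`stub_oneStepSmallLift`, `κ√L ≤ 1`) + fibre
positivity (WREG's INTERIOR∕CHARGE at that profile).  (m), (c), (a) of S1aᴴ untouched.

HONEST: plumbing over landed kernel facts (WREG ✓`…Wreg.windowRegularity`, FILE A); nothing of Bałaban's renormalisation-group analysis is asserted or proved; S1aᴴ ∕
`FirstExitWindowTailL` ∕ S2β ∕ `OrganDischargeInputsHJ` ∕ the five registered stubs (3732b7df) ∕ crux 20520 ∕ 19936 ∕ 19200 ∕ `YM3TorusSU2` NOT proved; registry untouched;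
rung R3 = SU(2) YM₃ on T³ at fixed lattice data — NOT d = 4, NOT infinite volume, NOT a mass gap, NOT Clay; the Yang–Mills mass gap is NOT proved by any of this.
References: [Balaban1985UV3] CMP 102 (1985) (2) p. 256, (7) p. 257, (41) p. 266, (47) p. 267; [Balaban1987RG1] CMP 109 (1987) (0.13) p. 254; [Balaban1985Averaging] CMP 98 (1985) (10) p. 19.
-/

set_option autoImplicit false

noncomputable section

namespace Summit.QuantumFields.YangMills.Theorems.FluctuationComparisonRegPrIntLS1aTowerDensityVersion

open MeasureTheory Filter Topology Set Function
open scoped ENNReal NNReal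
open Literature.MathematicalPhysics.QuantumFieldTheory.Balaban1983to89
open T3ContinuumYM3Torus T3NestedUnitLaws T3UnitLawDensityEML T3UnitScaleTilt T3LevelShift T3TiltDescent T4Continuum
open Literature.MathematicalPhysics.QuantumFieldTheory.Balaban1983to89.Missing
open scoped Literature.MathematicalPhysics.QuantumFieldTheory.Balaban1983to89.T3OrbitAverage
open Summit.QuantumFields.YangMills.Theorems.OrganTangentFibreMeanTools (continuous_dist1_plaqHol)
open Summit.QuantumFields.YangMills.Theorems.FluctuationComparisonRegPrIntLWregGlue (heightDensityCan WindowRegularity)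
open Summit.QuantumFields.YangMills.Theorems.FluctuationComparisonRegPrIntLWreg (windowRegularity)
open Summit.QuantumFields.YangMills.Theorems.FluctuationComparisonRegPrIntLS1aTowerLawSandwich

/-- The `δ`-window of a height is open (finitely many continuous plaquette distances). [cite: Balaban1985UV3, (7) p.257] -/
theorem isOpen_window {P : Params} (δ : ℝ) :
    IsOpen {U : GaugeField P 0 ↥(Matrix.specialUnitaryGroup (Fin 2) ℂ) | PlaqSmall δ U} := by
  have e : {U : GaugeField P 0 ↥(Matrix.specialUnitaryGroup (Fin 2) ℂ) | PlaqSmall δ U} = ⋂ p : Plaq P 0, {U | dist1 (GaugeField.plaqHol U p) < δ} := by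
    ext U; simp only [PlaqSmall, Set.mem_setOf_eq, Set.mem_iInter]
  rw [e]
  exact isOpen_iInter_of_finite fun p => isOpen_lt (continuous_dist1_plaqHol p) continuous_const

/-- ★★★ **(p) ∧ (w) FOR ONE VERSION, ON THE `b₁`-WINDOW**: for every `L`, `0 < b₁`, `0 < p₀` there is `γ₁ > 0` (WREG's) such that for every family of block size `L`,
every `0 < γ ≤ γ₁`, every run system `ν` and cut tower `μ` of S1aᴴ's shape with cut weights `χ ≤ 1` equal to one on the `θBal F.L γ b₁ p₀`-windows above height `j`, the
law `μ j` has a MEASURABLE NON-NEGATIVE density `ρ_j` with respect to product Haar that is STRICTLY POSITIVE on the `θBal F.L γ b₁ p₀ j`-window and sandwiched a.e.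
between `Z_K⁻¹·ρ^{histGood}_{K−j}` and `Z_K⁻¹·ρ_{K−j}`.  Proof: `ρ_j := max (dμ_j∕dU) (W.piecewise (Z_K⁻¹·heightDensityCan …) 0)`, ✓WREG `windowRegularity` at `(L, b₁, p₀)`
(window ⊆ `regSet`, canonical version positive on it) + lit ✓`Node00.canonVersion_ae_eq` + §3's lower bound. [cite: Balaban1985UV3, (2) p.256, (7) p.257 and (47) p.267] -/
theorem exists_density_pos_on_window (L : ℕ) {b₁ p₀ : ℝ} (hb₁ : 0 < b₁) (hp₀ : 0 < p₀) :
    ∃ γ₁ : ℝ, 0 < γ₁ ∧ ∀ (F : T3Family) (γ : ℝ), F.L = L → 0 < γ → γ ≤ γ₁ →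
      ∀ (χ : (i : ℕ) → GaugeField (F.P i) 0 ↥(Matrix.specialUnitaryGroup (Fin 2) ℂ) → ℝ≥0∞),
        (∀ i, Measurable (χ i)) → (∀ i U, χ i U ≤ 1) →
      ∀ (ν : ℕ → (j : ℕ) → Measure (GaugeField (F.P j) 0 ↥(Matrix.specialUnitaryGroup (Fin 2) ℂ))),
        (∀ K, ν K K = T4GenFunBounds.gibbsMeasure (F.P K) ((F.scheme ℰp γ).β K)) →
        (∀ K j, j < K → ν K j = Measure.map (descend F ℰp j) (ν K (j + 1))) →
      ∀ (K Ts : ℕ) (hTs : Ts ≤ K) (μ : (j : ℕ) → Measure (GaugeField (F.P j) 0 ↥(Matrix.specialUnitaryGroup (Fin 2) ℂ))),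
        (∀ j, Ts ≤ j → μ j = ν K j) →
        (∀ j, j < Ts → μ j = Measure.map (descend F ℰp j) ((μ (j + 1)).withDensity (χ (j + 1)))) →
      ∀ (j : ℕ) (hjK : j ≤ K), (∀ (i : ℕ), j < i → i ≤ Ts → ∀ U, PlaqSmall (θBal F.L γ b₁ p₀ i) U → χ i U = 1) →
        ∃ ρ : GaugeField (F.P j) 0 ↥(Matrix.specialUnitaryGroup (Fin 2) ℂ) → ℝ, Measurable ρ ∧ (∀ V, 0 ≤ ρ V) ∧
          μ j = (fieldMeasure (F.P j) 0 ↥(Matrix.specialUnitaryGroup (Fin 2) ℂ)).withDensity (fun V => ENNReal.ofReal (ρ V)) ∧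
          (∀ V, PlaqSmall (θBal F.L γ b₁ p₀ j) V → 0 < ρ V) ∧
          (∀ᵐ V ∂fieldMeasure (F.P j) 0 ↥(Matrix.specialUnitaryGroup (Fin 2) ℂ),
            (partitionFn (G := ↥(Matrix.specialUnitaryGroup (Fin 2) ℂ)) (F.P K) ((F.scheme ℰp γ).β K))⁻¹ *
                heightDensity F γ hjK (histGood F ℰp (θBal F.L γ b₁ p₀) K j) V ≤ ρ V ∧
              ρ V ≤ (partitionFn (G := ↥(Matrix.specialUnitaryGroup (Fin 2) ℂ)) (F.P K) ((F.scheme ℰp γ).β K))⁻¹ * heightDensity F γ hjK Set.univ V) := by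
  classical
  obtain ⟨γ₁, hγ₁, H⟩ := windowRegularity L b₁ p₀ hb₁ hp₀
  refine ⟨γ₁, hγ₁, fun F γ hFL hγ hγγ₁ χ hχm hχ1 ν hν1 hν2 K Ts hTs μ hanch hcut j hjK hplat => ?_⟩
  obtain ⟨hreg, hpos⟩ := H F γ hFL hγ hγγ₁ j K hjK γ hγ
  haveI : BorelSpace (GaugeField (F.P j) 0 ↥(Matrix.specialUnitaryGroup (Fin 2) ℂ)) := T3OrbitAverage.instBorelSpaceGaugeField
  haveI : SecondCountableTopology (GaugeField (F.P j) 0 ↥(Matrix.specialUnitaryGroup (Fin 2) ℂ)) := T3OrbitAverage.instSecondCountableGaugeField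
  haveI : (fieldMeasure (F.P j) 0 ↥(Matrix.specialUnitaryGroup (Fin 2) ℂ)).IsOpenPosMeasure :=
    B12ContinuousTransportInvariance.isOpenPosMeasure_fieldMeasure_SU (N := 2) (F.P j) 0
  -- names
  set E : Set (GaugeField (F.P K) 0 ↥(Matrix.specialUnitaryGroup (Fin 2) ℂ)) := histGood F ℰp (θBal F.L γ b₁ p₀) K j with hEdef
  set Z : ℝ := partitionFn (G := ↥(Matrix.specialUnitaryGroup (Fin 2) ℂ)) (F.P K) ((F.scheme ℰp γ).β K) with hZdef
  set W : Set (GaugeField (F.P j) 0 ↥(Matrix.specialUnitaryGroup (Fin 2) ℂ)) := {V | PlaqSmall (θBal F.L γ b₁ p₀ j) V} with hWdef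
  have hZ : 0 < Z := partitionFn_pos' _ (F.scheme_β_nonneg ℰp hγ.le K)
  have hEm : MeasurableSet E := measurableSet_histGood F ℰp measurableE_ℰp _ K j
  have hWo : IsOpen W := isOpen_window _
  have hWm : MeasurableSet W := hWo.measurableSet
  -- the law `μ j`: absolutely continuous, finite; its Radon–Nikodym density `r`
  have hAC : μ j ≪ fieldMeasure (F.P j) 0 ↥(Matrix.specialUnitaryGroup (Fin 2) ℂ) :=
    tower_absolutelyContinuous F χ ν μ hγ.le hχ1 hν1 hν2 hTs hanch hcut hjK
  haveI : IsFiniteMeasure (μ j) := isFiniteMeasure_tower F χ ν μ hγ.le hχ1 hν1 hν2 hTs hanch hcut hjK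
  set r : GaugeField (F.P j) 0 ↥(Matrix.specialUnitaryGroup (Fin 2) ℂ) → ℝ≥0∞ :=
    (μ j).rnDeriv (fieldMeasure (F.P j) 0 ↥(Matrix.specialUnitaryGroup (Fin 2) ℂ)) with hrdef
  have hμr : μ j = (fieldMeasure (F.P j) 0 ↥(Matrix.specialUnitaryGroup (Fin 2) ℂ)).withDensity r :=
    (Measure.withDensity_rnDeriv_eq _ _ hAC).symm
  have hrm : Measurable r := Measure.measurable_rnDeriv _ _
  have hrtop : ∀ᵐ V ∂fieldMeasure (F.P j) 0 ↥(Matrix.specialUnitaryGroup (Fin 2) ℂ), r V < ⊤ := Measure.rnDeriv_lt_top _ _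
  obtain ⟨hlow, hup⟩ := density_sandwich_ae F χ ν μ hγ.le hχm hχ1 hν1 hν2 hTs hanch hcut hjK hplat hrm hμr
  -- the canonical version of the restricted density: a version, continuous on `regSet ⊇ W`, positive on `W` (WREG)
  have hcan : heightDensityCan F γ hjK E =ᵐ[fieldMeasure (F.P j) 0 ↥(Matrix.specialUnitaryGroup (Fin 2) ℂ)] heightDensity F γ hjK E :=
    Node00.canonVersion_ae_eq
  have hgc : ContinuousOn (fun V => Z⁻¹ * heightDensityCan F γ hjK E V) W :=
    continuousOn_const.mul (Node00.continuousOn_canonVersion.mono hreg)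
  -- the version
  set g : GaugeField (F.P j) 0 ↥(Matrix.specialUnitaryGroup (Fin 2) ℂ) → ℝ := W.piecewise (fun V => Z⁻¹ * heightDensityCan F γ hjK E V) 0 with hgdef
  have hgm : Measurable g := ContinuousOn.measurable_piecewise hgc continuousOn_const hWm
  have hg_of_mem : ∀ V ∈ W, g V = Z⁻¹ * heightDensityCan F γ hjK E V := fun V hV => Set.piecewise_eq_of_mem _ _ _ hV
  have hg_of_not_mem : ∀ V ∉ W, g V = 0 := fun V hV => Set.piecewise_eq_of_notMem _ _ _ hV
  set ρ : GaugeField (F.P j) 0 ↥(Matrix.specialUnitaryGroup (Fin 2) ℂ) → ℝ := fun V => max (r V).toReal (g V) with hρdef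
  -- `ρ = r` almost everywhere
  have hρr : ∀ᵐ V ∂fieldMeasure (F.P j) 0 ↥(Matrix.specialUnitaryGroup (Fin 2) ℂ), ρ V = (r V).toReal := by
    filter_upwards [hlow, hrtop, hcan] with V h1 h2 h3
    have hgle : g V ≤ (r V).toReal := by
      by_cases hV : V ∈ W
      · rw [hg_of_mem V hV, h3]
        exact (ENNReal.ofReal_le_iff_le_toReal h2.ne).mp h1
      · rw [hg_of_not_mem V hV]
        exact ENNReal.toReal_nonneg
    exact max_eq_left hgle
  refine ⟨ρ, hrm.ennreal_toReal.max hgm, fun V => le_max_of_le_left ENNReal.toReal_nonneg, ?_, ?_, ?_⟩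
  · -- (w)
    rw [hμr]
    refine withDensity_congr_ae ?_
    filter_upwards [hρr, hrtop] with V h1 h2
    rw [h1, ENNReal.ofReal_toReal h2.ne]
  · -- (p) on the window
    intro V hV
    have h := hpos V hV
    have hgV : g V = Z⁻¹ * heightDensityCan F γ hjK E V := hg_of_mem V hV
    exact lt_of_lt_of_le (by rw [hgV]; exact mul_pos (inv_pos.mpr hZ) h) (le_max_right _ _)
  · -- the a.e. sandwich in real currency
    filter_upwards [hlow, hup, hrtop, hρr] with V h1 h2 h3 h4
    have h0 : 0 ≤ Z⁻¹ * heightDensity F γ hjK Set.univ V := mul_nonneg (inv_nonneg.mpr hZ.le) (heightDensity_nonneg F γ hjK _ V)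
    rw [h4]
    exact ⟨(ENNReal.ofReal_le_iff_le_toReal h3.ne).mp h1, ENNReal.toReal_le_of_le_ofReal h0 h2⟩


/-- ★★ **AT THE UNCUT HEIGHTS `Ts ≤ j ≤ K`: (p) ON THE FULL `b₁`-WINDOW ∧ (w), FOR ONE VERSION, WITH NO PLATEAU HYPOTHESIS** (there is no cut above `j`; `b₁ > 0` arbitrary —
for S1aᴴ take `b₁ := b₀`): `∃ ρ_j` measurable, `0 ≤ ρ_j`, `μ j = dU_j.withDensity (ofReal ∘ ρ_j)`, `0 < ρ_j` on the `θBal F.L γ b₁ p₀ j`-window, sandwiched a.e.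
[cite: Balaban1985UV3, (2) p.256, (7) p.257 and (47) p.267] -/
theorem exists_density_pos_on_window_of_le (L : ℕ) {b₁ p₀ : ℝ} (hb₁ : 0 < b₁) (hp₀ : 0 < p₀) :
    ∃ γ₁ : ℝ, 0 < γ₁ ∧ ∀ (F : T3Family) (γ : ℝ), F.L = L → 0 < γ → γ ≤ γ₁ →
      ∀ (χ : (i : ℕ) → GaugeField (F.P i) 0 ↥(Matrix.specialUnitaryGroup (Fin 2) ℂ) → ℝ≥0∞),
        (∀ i, Measurable (χ i)) → (∀ i U, χ i U ≤ 1) →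
      ∀ (ν : ℕ → (j : ℕ) → Measure (GaugeField (F.P j) 0 ↥(Matrix.specialUnitaryGroup (Fin 2) ℂ))),
        (∀ K, ν K K = T4GenFunBounds.gibbsMeasure (F.P K) ((F.scheme ℰp γ).β K)) →
        (∀ K j, j < K → ν K j = Measure.map (descend F ℰp j) (ν K (j + 1))) →
      ∀ (K Ts : ℕ) (hTs : Ts ≤ K) (μ : (j : ℕ) → Measure (GaugeField (F.P j) 0 ↥(Matrix.specialUnitaryGroup (Fin 2) ℂ))),
        (∀ j, Ts ≤ j → μ j = ν K j) →
        (∀ j, j < Ts → μ j = Measure.map (descend F ℰp j) ((μ (j + 1)).withDensity (χ (j + 1)))) →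
      ∀ (j : ℕ) (hjK : j ≤ K), Ts ≤ j →
        ∃ ρ : GaugeField (F.P j) 0 ↥(Matrix.specialUnitaryGroup (Fin 2) ℂ) → ℝ, Measurable ρ ∧ (∀ V, 0 ≤ ρ V) ∧
          μ j = (fieldMeasure (F.P j) 0 ↥(Matrix.specialUnitaryGroup (Fin 2) ℂ)).withDensity (fun V => ENNReal.ofReal (ρ V)) ∧
          (∀ V, PlaqSmall (θBal F.L γ b₁ p₀ j) V → 0 < ρ V) ∧
          (∀ᵐ V ∂fieldMeasure (F.P j) 0 ↥(Matrix.specialUnitaryGroup (Fin 2) ℂ),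
            (partitionFn (G := ↥(Matrix.specialUnitaryGroup (Fin 2) ℂ)) (F.P K) ((F.scheme ℰp γ).β K))⁻¹ *
                heightDensity F γ hjK (histGood F ℰp (θBal F.L γ b₁ p₀) K j) V ≤ ρ V ∧
              ρ V ≤ (partitionFn (G := ↥(Matrix.specialUnitaryGroup (Fin 2) ℂ)) (F.P K) ((F.scheme ℰp γ).β K))⁻¹ * heightDensity F γ hjK Set.univ V) := by
  obtain ⟨γ₁, hγ₁, H⟩ := exists_density_pos_on_window L hb₁ hp₀
  refine ⟨γ₁, hγ₁, fun F γ hFL hγ hγγ₁ χ hχm hχ1 ν hν1 hν2 K Ts hTs μ hanch hcut j hjK hTj => ?_⟩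
  exact H F γ hFL hγ hγγ₁ χ hχm hχ1 ν hν1 hν2 K Ts hTs μ hanch hcut j hjK (fun i hji hiT => absurd (hTj.trans_lt hji) (not_lt.mpr hiT))

/-- ★★★ **ONE FAMILY OF VERSIONS FOR ALL HEIGHTS `j ≤ K` — S1aᴴ's `∃ ρ, ∀ j (hjK : j ≤ K), …` SHAPE restricted to (p on the `b₁`-window) ∧ (w)**, under the GLOBAL plateau
hypothesis `PlaqSmall (θBal F.L γ b₁ p₀ i) U → χ i U = 1` for all `i ≤ Ts` (the line's `sfCut (θBal F.L γ b₀ p₀ i)` satisfies it with `b₁ = b₀∕2`): for `0 < γ ≤ γ₁(L, b₁, p₀)`,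
`∃ ρ : (j : ℕ) → …, ∀ j ≤ K`: `ρ j` measurable, `0 ≤ ρ j`, `μ j = dU_j.withDensity (ofReal ∘ ρ j)`, `0 < ρ j` on the `θBal F.L γ b₁ p₀ j`-window, and the a.e. sandwich.
[cite: Balaban1985UV3, (2) p.256, (7) p.257, (41) p.266 and (47) p.267] -/
theorem exists_densities (L : ℕ) {b₁ p₀ : ℝ} (hb₁ : 0 < b₁) (hp₀ : 0 < p₀) :
    ∃ γ₁ : ℝ, 0 < γ₁ ∧ ∀ (F : T3Family) (γ : ℝ), F.L = L → 0 < γ → γ ≤ γ₁ →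
      ∀ (χ : (i : ℕ) → GaugeField (F.P i) 0 ↥(Matrix.specialUnitaryGroup (Fin 2) ℂ) → ℝ≥0∞),
        (∀ i, Measurable (χ i)) → (∀ i U, χ i U ≤ 1) →
      ∀ (ν : ℕ → (j : ℕ) → Measure (GaugeField (F.P j) 0 ↥(Matrix.specialUnitaryGroup (Fin 2) ℂ))),
        (∀ K, ν K K = T4GenFunBounds.gibbsMeasure (F.P K) ((F.scheme ℰp γ).β K)) →
        (∀ K j, j < K → ν K j = Measure.map (descend F ℰp j) (ν K (j + 1))) →
      ∀ (K Ts : ℕ) (hTs : Ts ≤ K) (μ : (j : ℕ) → Measure (GaugeField (F.P j) 0 ↥(Matrix.specialUnitaryGroup (Fin 2) ℂ))),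
        (∀ j, Ts ≤ j → μ j = ν K j) →
        (∀ j, j < Ts → μ j = Measure.map (descend F ℰp j) ((μ (j + 1)).withDensity (χ (j + 1)))) →
        (∀ (i : ℕ), i ≤ Ts → ∀ U, PlaqSmall (θBal F.L γ b₁ p₀ i) U → χ i U = 1) →
        ∃ ρ : (j : ℕ) → GaugeField (F.P j) 0 ↥(Matrix.specialUnitaryGroup (Fin 2) ℂ) → ℝ,
          ∀ (j : ℕ) (hjK : j ≤ K), Measurable (ρ j) ∧ (∀ V, 0 ≤ ρ j V) ∧
            μ j = (fieldMeasure (F.P j) 0 ↥(Matrix.specialUnitaryGroup (Fin 2) ℂ)).withDensity (fun V => ENNReal.ofReal (ρ j V)) ∧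
            (∀ V, PlaqSmall (θBal F.L γ b₁ p₀ j) V → 0 < ρ j V) ∧
            (∀ᵐ V ∂fieldMeasure (F.P j) 0 ↥(Matrix.specialUnitaryGroup (Fin 2) ℂ),
              (partitionFn (G := ↥(Matrix.specialUnitaryGroup (Fin 2) ℂ)) (F.P K) ((F.scheme ℰp γ).β K))⁻¹ *
                  heightDensity F γ hjK (histGood F ℰp (θBal F.L γ b₁ p₀) K j) V ≤ ρ j V ∧
                ρ j V ≤ (partitionFn (G := ↥(Matrix.specialUnitaryGroup (Fin 2) ℂ)) (F.P K) ((F.scheme ℰp γ).β K))⁻¹ * heightDensity F γ hjK Set.univ V) := by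
  classical
  obtain ⟨γ₁, hγ₁, H⟩ := exists_density_pos_on_window L hb₁ hp₀
  refine ⟨γ₁, hγ₁, fun F γ hFL hγ hγγ₁ χ hχm hχ1 ν hν1 hν2 K Ts hTs μ hanch hcut hplat => ?_⟩
  have H' : ∀ (j : ℕ) (hjK : j ≤ K), ∃ ρ : GaugeField (F.P j) 0 ↥(Matrix.specialUnitaryGroup (Fin 2) ℂ) → ℝ, Measurable ρ ∧ (∀ V, 0 ≤ ρ V) ∧
      μ j = (fieldMeasure (F.P j) 0 ↥(Matrix.specialUnitaryGroup (Fin 2) ℂ)).withDensity (fun V => ENNReal.ofReal (ρ V)) ∧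
      (∀ V, PlaqSmall (θBal F.L γ b₁ p₀ j) V → 0 < ρ V) ∧
      (∀ᵐ V ∂fieldMeasure (F.P j) 0 ↥(Matrix.specialUnitaryGroup (Fin 2) ℂ),
        (partitionFn (G := ↥(Matrix.specialUnitaryGroup (Fin 2) ℂ)) (F.P K) ((F.scheme ℰp γ).β K))⁻¹ *
            heightDensity F γ hjK (histGood F ℰp (θBal F.L γ b₁ p₀) K j) V ≤ ρ V ∧
          ρ V ≤ (partitionFn (G := ↥(Matrix.specialUnitaryGroup (Fin 2) ℂ)) (F.P K) ((F.scheme ℰp γ).β K))⁻¹ * heightDensity F γ hjK Set.univ V) :=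
    fun j hjK => H F γ hFL hγ hγγ₁ χ hχm hχ1 ν hν1 hν2 K Ts hTs μ hanch hcut j hjK (fun i _ hiT U hU => hplat i hiT U hU)
  choose ρ hρ using H'
  refine ⟨fun j => if h : j ≤ K then ρ j h else fun _ => 0, fun j hjK => ?_⟩
  simp only [dif_pos hjK]
  exact hρ j hjK

end Summit.QuantumFields.YangMills.Theorems.FluctuationComparisonRegPrIntLS1aTowerDensityVersion

end
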